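import Literature.MathematicalPhysics.QuantumFieldTheory.Balaban1983to89.B8Eq1118PicardAnalytic
import Mathlib.Analysis.Complex.LocallyUniformLimit

/-!
# `Balaban1983to89.B8Eq1117ConcreteAnalytic` — T. Bałaban, *Spaces of regular gauge field configurations on a lattice and gauge fixing
# conditions*, Commun. Math. Phys. **99** (1985) 75–102 [Balaban1985RegularSpaces], Sect. E p. 97: «This solution is an analytic
# function of λ defined on the set of λ satisfying (1.119)» — PROVED FOR THE CONCRETE LATTICE `C′ = C′_j(u₁, ·)` / `D′ = B8Eq1113Concrete.Dprime`
# (file 3 of 3; file 1 = `B8CprimeCurveAnalytic`, file 2 = `B8Eq1118PicardAnalytic`)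

statement-level skeleton of published theorems with citation tags; proofs where landed; nothing here is a claim about the Yang–Mills mass gap

PDF held: `paper:balaban1985-cmp99-regular-spaces-gauge-fixing` (journal page = PDF page + 74); p. 97 [PDF 23] read from the text layer
(`p0023.txt` L12–L13, this unit, 2026-08-21): «exists exactly one solution of Eq. (1.117). This solution is an analytic function of λ
defined on the set of λ satisfying (1.119). We take D′(λ) equal to this solution.»; p. 96 [PDF 22]: «We may admit configurations λ, X
with values in the complexified algebra 𝔤ᶜ and all the above equations and inequalities are valid also.»; (1.113) p. 95: «the
transformation λ′ = λ − H′D′(λ) (1.113) changes the function Q′(λ′) into the linear function Q′λ».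

CITATION HEADER (lean-in-tree rule).  Cell `lit-balaban` (HOME `run/shared/lean/pub/lit-balaban/`), unit `lit-balaban-p05` (Phase-2 proof
seat p05, gen 6; TAKING line HOME/STATUS.md 2026-08-21T09:39:21Z; free-target protocol G.5-34(d); owner of block B8 = `lit-balaban-r05`,
referee ref-4).  WHAT IS REPRODUCED = SKELETON rows **`B8.Eq1.113`** / **`B8.Claim@97`**, the p. 97 sentence above, hitherto PROVED ONLY
AT THE ABSTRACT BANACH LEVEL (r05 `B8Eq1117Analytic.Dprime_analyticAt`, E-B8-14, with the Banach-analyticity of `C′` as hypothesis);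
HERE for the CONCRETE lattice remainder `C′ = B8Eq1117Concrete.CnlF` and the concrete `D′ = B8Eq1113Concrete.Dprime` (this unit, gen 5;
`H′` abstract with the (1.92)/(1.120)-type modulus bounds), UNCONDITIONALLY, in the curve form.

WHAT THIS FILE PROVES (kernel, no `sorry`, standard axioms; theorems only; hypotheses = those of `B8Eq1117Concrete.eq1117_existsUnique`
along the family, plus `0 < α₄`):
* **`differentiableOn_Dprime_comp`** / **`analyticOnNhd_Dprime_comp`** — for every sitewise-holomorphic family `γ : V → (ℤᵈ → 𝔸)`, `V ⊂ ℂ`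
  open, with values in the set (1.119) (`‖R(U₀(b))γ(t)(b₊) − γ(t)(b₋)‖ < ½α₄η`, `‖γ(t)(x)‖ < ½α₄`, `η = L⁻ᵏ`), the solution
  `t ↦ D′(γ(t))` is complex differentiable, indeed ANALYTIC, on `V` as a map into the Banach space `XSpace d k 𝔸` of the `X`'s.
  PROOF (print gives none beyond «by the contraction mapping theorem»; the standard one): the Picard iterates of (1.118) are holomorphic
  along the family (file 2 `picard_iterate`, from file 1's Banach-valued (208)) and converge uniformly on `V` (file 2
  `tendstoUniformlyOn_picard`, contraction constant `½`), so the limit is holomorphic (Mathlib `TendstoLocallyUniformlyOn.differentiableOn`).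
* `analyticOnNhd_Dprime_comp_apply` — every site value `t ↦ D′(γ(t))(j, x)` is analytic on `V`.
* `analyticOnNhd_linMap_comp_apply` — (1.113): every site value of `t ↦ γ(t) − H′D′(γ(t))` is analytic on `V`.
* `analyticOnNhd_Dprime_line` / `analyticAt_Dprime_line` — the complex line of (1.124): for `λ` in the quarter-size set and a direction
  `λ₀` of modulus `≤ m` (sitewise and covariant-difference bounds), `τ ↦ D′(λ + τλ₀)` is analytic on `|τ| < α₄/(4m)` (the line stays
  in (1.119): `B8Eq1123Concrete.line_mem_dom207` at `½α₄`), in particular at `τ = 0`.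
READINGS (recorded; none is an objection to print).  (a) «analytic function of λ defined on the set of λ satisfying (1.119)»: on the
infinite lattice `ℤᵈ` of the series the statement is rendered in the curve form — analytic along every holomorphic one-parameter family
INSIDE the set (the form print uses in (1.124)); the Fréchet form on a Banach space of `λ`'s (norm `max{|λ|, Lᵏ|Dλ|}`) follows from
file 1 §2 (G-holomorphy + boundedness of `C′`) by the tree's Graves–Taylor–Hille–Zorn theorem
(`Literature.Analysis.Complex.GateauxHolomorphic.differentiableOn_of_gateaux_of_bounded`) once that space is fixed (unit r05,
`B8Eq1119LambdaSpace`; not knitted here).  (b)–(d) as in `B8Eq1117Concrete`: `𝔤ᶜ`-values, one-level (207)-domain, `H′` abstract,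
`C′₂ := 2·C2p d` in the smallness (GAPS G-B8-17), closed ball `‖X‖ ≤ α₄/(2B′₀)`.  NOT CLAIMED: the lattice `H′` (row B8.Eq1.91 /
I-B8-2); the onto sentence of p. 97 (abstract: `B8Claim97OntoProof`; concrete: r05 in progress).
REUSED BY NAME: `B8Eq1118PicardAnalytic.picard_iterate, tendstoUniformlyOn_picard`, `B8Eq1113Concrete.Dprime`,
`B8Eq1123Concrete.line_mem_dom207`, `B8Eq1117Concrete.XSpace, fpMap`, Mathlib `TendstoLocallyUniformlyOn.differentiableOn`,
`DifferentiableOn.analyticOnNhd`, `BoundedContinuousFunction.evalCLM`, `LinearMap.mkContinuous`.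
Unit `lit-balaban-p05` (gen 6), 2026-08-21.  Nothing here is new mathematics.

[cite: Balaban1985RegularSpaces, p.97 («This solution is an analytic function of λ defined on the set of λ satisfying (1.119)»), (1.113)
p.95, (1.117)–(1.119) p.96, (1.124) p.97; Balaban1985Averaging, (208) p.50]
-/

noncomputable section

open NormedSpace Finset Metric Set Filter
open scoped BoundedContinuousFunction Topology NNReal

namespace Literature.MathematicalPhysics.QuantumFieldTheory.Balaban1983to89.B8Eq1117ConcreteAnalytic

open B7Prop1Explicit B7Prop2Explicit MatrixLog B7Eq167Flat B7Prop9Flat B7Prop10General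
open B7Eq170Flat (cj)
open B8Ineq125Concrete (C2p)
open B8Eq1117Concrete (XSpace fpMap)
open B8Eq1113Concrete (Dprime)
open B8Eq1118PicardAnalytic (picard_iterate tendstoUniformlyOn_picard)

-- `Site` alone would resolve to the torus sites of `Setup.lean`; re-export the `ℤ^d` sites of `B7Prop1Explicit`.
export B7Prop1Explicit (Site)

variable {d : ℕ}

/-! ## «This solution is an analytic function of λ» (p. 97) for the concrete `D′` -/

section DprimeAnalytic

variable {𝔸 : Type*} [NormedRing 𝔸] [NormOneClass 𝔸] [NormedAlgebra ℂ 𝔸] [CompleteSpace 𝔸]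

/-- **p. 97 [PDF 23], verbatim: *"Thus by the contraction mapping theorem there exists exactly one solution of Eq. (1.117). This
solution is an analytic function of λ defined on the set of λ satisfying (1.119)."*** — FOR THE CONCRETE LATTICE `C′ = C′_j(u₁, ·)`
and `D′ = B8Eq1113Concrete.Dprime` (`H′` abstract with the (1.92)/(1.120)-type modulus bounds), in the curve form of READING (a):
along every sitewise-holomorphic family `γ` on an open `V ⊂ ℂ` with values in the set (1.119) (`‖R(U₀(b))γ(t)(b₊) − γ(t)(b₋)‖ <
½α₄η`, `‖γ(t)(x)‖ < ½α₄`, `η = L⁻ᵏ`), the solution `t ↦ D′(γ(t))` is complex differentiable on `V` as an `XSpace`-valued map —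
the Picard iterates are holomorphic (`picard_iterate`) and converge uniformly (`tendstoUniformlyOn_picard`), so the limit is holomorphic
(Mathlib `TendstoLocallyUniformlyOn.differentiableOn`).  Hypotheses = those of `B8Eq1117Concrete.eq1117_existsUnique` along the family
(p. 96 «We may admit configurations λ, X with values in the complexified algebra 𝔤ᶜ …» licenses complex `t`).
[cite: Balaban1985RegularSpaces, p.97 («This solution is an analytic function of λ defined on the set of λ satisfying (1.119)»), (1.117)–(1.119) p.96] -/
theorem differentiableOn_Dprime_comp {L : ℕ} (hL : 2 ≤ L) {G : Subgroup 𝔸ˣ} (hG : AvgClosed d L G) {U₀ : Site d → Fin d → 𝔸ˣ}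
    (hU : ∀ x κ, U₀ x κ ∈ G) {k : ℕ} (H' : XSpace d k 𝔸 →ₗ[ℂ] (Site d → 𝔸))
    {u₁ : Site d → 𝔸ˣ} {α₀ α₃ α₄ B₀' : ℝ}
    (hα : 0 < α₀) (hα3 : C0 d * α₀ ≤ 1 / 3) (hα2 : 2 * α₀ ≤ c2' d L)
    (h52 : pdev U₀ < α₀ * (((L : ℝ) ^ k)⁻¹) ^ 2)
    (hB : 0 < B₀')
    (hH0 : ∀ (X : XSpace d k 𝔸) (x : Site d), ‖H' X x‖ ≤ B₀' * ‖X‖)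
    (hH1 : ∀ (X : XSpace d k 𝔸) (x : Site d) (κ : Fin d),
      ‖cj (U₀ x κ) (H' X (x + e κ)) - H' X x‖ ≤ B₀' * ‖X‖ * ((L : ℝ) ^ k)⁻¹)
    {γ : ℂ → Site d → 𝔸} {V : Set ℂ} (hV : IsOpen V) (hγ : ∀ x, DifferentiableOn ℂ (fun t => γ t x) V)
    (h119a : ∀ t ∈ V, ∀ (x : Site d) (κ : Fin d), ‖cj (U₀ x κ) (γ t (x + e κ)) - γ t x‖ < α₄ / 2 * ((L : ℝ) ^ k)⁻¹)
    (h119b : ∀ t ∈ V, ∀ x : Site d, ‖γ t x‖ < α₄ / 2)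
    (hu₁ : InLambda L U₀ u₁ k α₃ (((L : ℝ) ^ k)⁻¹))
    (hα₃ : 0 ≤ α₃) (hα₃' : α₃ ≤ 1 / 200) (hα₄ : 0 < α₄)
    (hs₁ : 200 * C6 d * (2 * α₄) ≤ 1) (hs₂ : 12000 * ((d : ℝ) + 1) * L * (2 * α₄) ≤ 1)
    (hs₃ : C4G d L * (α₀ + α₃ + 4 * (2 * α₄)) ≤ 1)
    (hs₄ : 1024 * ((d : ℝ) + 1) * ((d : ℝ) + 4) * L ^ 2 * α₀ ≤ 1) (hs₅ : 32 * ((d : ℝ) + 1) ^ 2 * C6 d * L ^ 2 * α₀ ≤ 1)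
    (hs₆ : 16 * d * C5' d * C6 d * (L : ℝ) ^ 2 * α₀ ≤ 1) (hs₇ : 8 * d * C6 d * L * α₀ ≤ 1)
    (hsm : α₃ + α₄ ≤ 1 / (4 * B₀' * (2 * C2p d))) :
    DifferentiableOn ℂ (fun t => Dprime L U₀ u₁ k H' (α₄ / (2 * B₀')) (γ t)) V :=
  (tendstoUniformlyOn_picard hL hG hU H' hα hα3 hα2 h52 hB hH0 hH1 hV hγ h119a h119b hu₁ hα₃ hα₃' hα₄ hs₁ hs₂ hs₃ hs₄ hs₅ hs₆ hs₇ hsm).tendstoLocallyUniformlyOn.differentiableOn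
    (Eventually.of_forall fun n => (picard_iterate hL hG hU H' hα hα3 hα2 h52 hB hH0 hH1 hV hγ h119a h119b hu₁ hα₃ hα₃' hα₄ hs₁ hs₂ hs₃ hs₄ hs₅ hs₆ hs₇ hsm n).2.1) hV

/-- **«This solution is an analytic function of λ»** (p. 97), concrete `D′`, curve form: `t ↦ D′(γ(t))` is ANALYTIC on `V` as an
`XSpace`-valued map (hypotheses of `differentiableOn_Dprime_comp`).
[cite: Balaban1985RegularSpaces, p.97 («This solution is an analytic function of λ defined on the set of λ satisfying (1.119)»)] -/
theorem analyticOnNhd_Dprime_comp {L : ℕ} (hL : 2 ≤ L) {G : Subgroup 𝔸ˣ} (hG : AvgClosed d L G) {U₀ : Site d → Fin d → 𝔸ˣ}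
    (hU : ∀ x κ, U₀ x κ ∈ G) {k : ℕ} (H' : XSpace d k 𝔸 →ₗ[ℂ] (Site d → 𝔸))
    {u₁ : Site d → 𝔸ˣ} {α₀ α₃ α₄ B₀' : ℝ}
    (hα : 0 < α₀) (hα3 : C0 d * α₀ ≤ 1 / 3) (hα2 : 2 * α₀ ≤ c2' d L)
    (h52 : pdev U₀ < α₀ * (((L : ℝ) ^ k)⁻¹) ^ 2)
    (hB : 0 < B₀')
    (hH0 : ∀ (X : XSpace d k 𝔸) (x : Site d), ‖H' X x‖ ≤ B₀' * ‖X‖)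
    (hH1 : ∀ (X : XSpace d k 𝔸) (x : Site d) (κ : Fin d),
      ‖cj (U₀ x κ) (H' X (x + e κ)) - H' X x‖ ≤ B₀' * ‖X‖ * ((L : ℝ) ^ k)⁻¹)
    {γ : ℂ → Site d → 𝔸} {V : Set ℂ} (hV : IsOpen V) (hγ : ∀ x, DifferentiableOn ℂ (fun t => γ t x) V)
    (h119a : ∀ t ∈ V, ∀ (x : Site d) (κ : Fin d), ‖cj (U₀ x κ) (γ t (x + e κ)) - γ t x‖ < α₄ / 2 * ((L : ℝ) ^ k)⁻¹)
    (h119b : ∀ t ∈ V, ∀ x : Site d, ‖γ t x‖ < α₄ / 2)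
    (hu₁ : InLambda L U₀ u₁ k α₃ (((L : ℝ) ^ k)⁻¹))
    (hα₃ : 0 ≤ α₃) (hα₃' : α₃ ≤ 1 / 200) (hα₄ : 0 < α₄)
    (hs₁ : 200 * C6 d * (2 * α₄) ≤ 1) (hs₂ : 12000 * ((d : ℝ) + 1) * L * (2 * α₄) ≤ 1)
    (hs₃ : C4G d L * (α₀ + α₃ + 4 * (2 * α₄)) ≤ 1)
    (hs₄ : 1024 * ((d : ℝ) + 1) * ((d : ℝ) + 4) * L ^ 2 * α₀ ≤ 1) (hs₅ : 32 * ((d : ℝ) + 1) ^ 2 * C6 d * L ^ 2 * α₀ ≤ 1)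
    (hs₆ : 16 * d * C5' d * C6 d * (L : ℝ) ^ 2 * α₀ ≤ 1) (hs₇ : 8 * d * C6 d * L * α₀ ≤ 1)
    (hsm : α₃ + α₄ ≤ 1 / (4 * B₀' * (2 * C2p d))) :
    AnalyticOnNhd ℂ (fun t => Dprime L U₀ u₁ k H' (α₄ / (2 * B₀')) (γ t)) V :=
  (differentiableOn_Dprime_comp hL hG hU H' hα hα3 hα2 h52 hB hH0 hH1 hV hγ h119a h119b hu₁ hα₃ hα₃' hα₄ hs₁ hs₂ hs₃ hs₄ hs₅ hs₆ hs₇ hsm).analyticOnNhd hV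

/-- … in particular every site value `t ↦ D′(γ(t))(j, x)` (`j ≤ k`, `x ∈ ℤᵈ`) is an analytic function on `V` (evaluation is a
continuous linear map on `XSpace`). [cite: Balaban1985RegularSpaces, p.97 («This solution is an analytic function of λ»)] -/
theorem analyticOnNhd_Dprime_comp_apply {L : ℕ} (hL : 2 ≤ L) {G : Subgroup 𝔸ˣ} (hG : AvgClosed d L G) {U₀ : Site d → Fin d → 𝔸ˣ}
    (hU : ∀ x κ, U₀ x κ ∈ G) {k : ℕ} (H' : XSpace d k 𝔸 →ₗ[ℂ] (Site d → 𝔸))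
    {u₁ : Site d → 𝔸ˣ} {α₀ α₃ α₄ B₀' : ℝ}
    (hα : 0 < α₀) (hα3 : C0 d * α₀ ≤ 1 / 3) (hα2 : 2 * α₀ ≤ c2' d L)
    (h52 : pdev U₀ < α₀ * (((L : ℝ) ^ k)⁻¹) ^ 2)
    (hB : 0 < B₀')
    (hH0 : ∀ (X : XSpace d k 𝔸) (x : Site d), ‖H' X x‖ ≤ B₀' * ‖X‖)
    (hH1 : ∀ (X : XSpace d k 𝔸) (x : Site d) (κ : Fin d),
      ‖cj (U₀ x κ) (H' X (x + e κ)) - H' X x‖ ≤ B₀' * ‖X‖ * ((L : ℝ) ^ k)⁻¹)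
    {γ : ℂ → Site d → 𝔸} {V : Set ℂ} (hV : IsOpen V) (hγ : ∀ x, DifferentiableOn ℂ (fun t => γ t x) V)
    (h119a : ∀ t ∈ V, ∀ (x : Site d) (κ : Fin d), ‖cj (U₀ x κ) (γ t (x + e κ)) - γ t x‖ < α₄ / 2 * ((L : ℝ) ^ k)⁻¹)
    (h119b : ∀ t ∈ V, ∀ x : Site d, ‖γ t x‖ < α₄ / 2)
    (hu₁ : InLambda L U₀ u₁ k α₃ (((L : ℝ) ^ k)⁻¹))
    (hα₃ : 0 ≤ α₃) (hα₃' : α₃ ≤ 1 / 200) (hα₄ : 0 < α₄)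
    (hs₁ : 200 * C6 d * (2 * α₄) ≤ 1) (hs₂ : 12000 * ((d : ℝ) + 1) * L * (2 * α₄) ≤ 1)
    (hs₃ : C4G d L * (α₀ + α₃ + 4 * (2 * α₄)) ≤ 1)
    (hs₄ : 1024 * ((d : ℝ) + 1) * ((d : ℝ) + 4) * L ^ 2 * α₀ ≤ 1) (hs₅ : 32 * ((d : ℝ) + 1) ^ 2 * C6 d * L ^ 2 * α₀ ≤ 1)
    (hs₆ : 16 * d * C5' d * C6 d * (L : ℝ) ^ 2 * α₀ ≤ 1) (hs₇ : 8 * d * C6 d * L * α₀ ≤ 1)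
    (hsm : α₃ + α₄ ≤ 1 / (4 * B₀' * (2 * C2p d))) (p : Fin (k + 1) × Site d) :
    AnalyticOnNhd ℂ (fun t => Dprime L U₀ u₁ k H' (α₄ / (2 * B₀')) (γ t) p) V := by
  have hD := differentiableOn_Dprime_comp hL hG hU H' hα hα3 hα2 h52 hB hH0 hH1 hV hγ h119a h119b hu₁ hα₃ hα₃' hα₄ hs₁ hs₂ hs₃ hs₄ hs₅ hs₆ hs₇ hsm
  have h := (BoundedContinuousFunction.evalCLM ℂ p).differentiable.comp_differentiableOn hD
  have h' : DifferentiableOn ℂ (fun t => Dprime L U₀ u₁ k H' (α₄ / (2 * B₀')) (γ t) p) V := by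
    simpa only [Function.comp_def, BoundedContinuousFunction.evalCLM_apply] using h
  exact h'.analyticOnNhd hV

/-- **The linearizing transformation (1.113) `λ′ = λ − H′D′(λ)` is analytic along the family**: every site value
`t ↦ γ(t)(x) − (H′D′(γ(t)))(x)` is analytic on `V` (p. 95 (1.113) with p. 97's analyticity of `D′`; `X ↦ (H′X)(x)` is a bounded
linear map by the modulus bound `‖(H′X)(x)‖ ≤ B′₀‖X‖`).
[cite: Balaban1985RegularSpaces, (1.113) p.95, p.97 («This solution is an analytic function of λ»)] -/
theorem analyticOnNhd_linMap_comp_apply {L : ℕ} (hL : 2 ≤ L) {G : Subgroup 𝔸ˣ} (hG : AvgClosed d L G) {U₀ : Site d → Fin d → 𝔸ˣ}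
    (hU : ∀ x κ, U₀ x κ ∈ G) {k : ℕ} (H' : XSpace d k 𝔸 →ₗ[ℂ] (Site d → 𝔸))
    {u₁ : Site d → 𝔸ˣ} {α₀ α₃ α₄ B₀' : ℝ}
    (hα : 0 < α₀) (hα3 : C0 d * α₀ ≤ 1 / 3) (hα2 : 2 * α₀ ≤ c2' d L)
    (h52 : pdev U₀ < α₀ * (((L : ℝ) ^ k)⁻¹) ^ 2)
    (hB : 0 < B₀')
    (hH0 : ∀ (X : XSpace d k 𝔸) (x : Site d), ‖H' X x‖ ≤ B₀' * ‖X‖)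
    (hH1 : ∀ (X : XSpace d k 𝔸) (x : Site d) (κ : Fin d),
      ‖cj (U₀ x κ) (H' X (x + e κ)) - H' X x‖ ≤ B₀' * ‖X‖ * ((L : ℝ) ^ k)⁻¹)
    {γ : ℂ → Site d → 𝔸} {V : Set ℂ} (hV : IsOpen V) (hγ : ∀ x, DifferentiableOn ℂ (fun t => γ t x) V)
    (h119a : ∀ t ∈ V, ∀ (x : Site d) (κ : Fin d), ‖cj (U₀ x κ) (γ t (x + e κ)) - γ t x‖ < α₄ / 2 * ((L : ℝ) ^ k)⁻¹)
    (h119b : ∀ t ∈ V, ∀ x : Site d, ‖γ t x‖ < α₄ / 2)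
    (hu₁ : InLambda L U₀ u₁ k α₃ (((L : ℝ) ^ k)⁻¹))
    (hα₃ : 0 ≤ α₃) (hα₃' : α₃ ≤ 1 / 200) (hα₄ : 0 < α₄)
    (hs₁ : 200 * C6 d * (2 * α₄) ≤ 1) (hs₂ : 12000 * ((d : ℝ) + 1) * L * (2 * α₄) ≤ 1)
    (hs₃ : C4G d L * (α₀ + α₃ + 4 * (2 * α₄)) ≤ 1)
    (hs₄ : 1024 * ((d : ℝ) + 1) * ((d : ℝ) + 4) * L ^ 2 * α₀ ≤ 1) (hs₅ : 32 * ((d : ℝ) + 1) ^ 2 * C6 d * L ^ 2 * α₀ ≤ 1)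
    (hs₆ : 16 * d * C5' d * C6 d * (L : ℝ) ^ 2 * α₀ ≤ 1) (hs₇ : 8 * d * C6 d * L * α₀ ≤ 1)
    (hsm : α₃ + α₄ ≤ 1 / (4 * B₀' * (2 * C2p d))) (x : Site d) :
    AnalyticOnNhd ℂ (fun t => γ t x - H' (Dprime L U₀ u₁ k H' (α₄ / (2 * B₀')) (γ t)) x) V := by
  have hD := differentiableOn_Dprime_comp hL hG hU H' hα hα3 hα2 h52 hB hH0 hH1 hV hγ h119a h119b hu₁ hα₃ hα₃' hα₄ hs₁ hs₂ hs₃ hs₄ hs₅ hs₆ hs₇ hsm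
  let Hx : XSpace d k 𝔸 →L[ℂ] 𝔸 :=
    ((LinearMap.proj x : (Site d → 𝔸) →ₗ[ℂ] 𝔸).comp H').mkContinuous B₀' fun Y => by
      simpa using hH0 Y x
  have hHx : ∀ Y, Hx Y = H' Y x := fun Y => rfl
  have h1 : DifferentiableOn ℂ (fun t => H' (Dprime L U₀ u₁ k H' (α₄ / (2 * B₀')) (γ t)) x) V := by
    have h := Hx.differentiable.comp_differentiableOn hD
    simpa only [Function.comp_def, hHx] using h
  exact ((hγ x).fun_sub h1).analyticOnNhd hV

/-- **The complex line `τ ↦ D′(λ + τλ₀)`** (the shape print uses in (1.124)): for `λ` in the QUARTER-size set (`‖R(U₀(b))λ(b₊) −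
λ(b₋)‖ < ¼α₄η`, `‖λ(x)‖ < ¼α₄`) and a direction `λ₀` of modulus `max{|λ₀|, |Dλ₀|} ≤ m` (`‖R(U₀(b))λ₀(b₊) − λ₀(b₋)‖ ≤ mη`,
`‖λ₀(x)‖ ≤ m`, `m > 0`), the line stays in the set (1.119) for `|τ| < α₄/(4m)` (`B8Eq1123Concrete.line_mem_dom207` at `½α₄`), so
`τ ↦ D′(λ + τλ₀)` is analytic on that disc as an `XSpace`-valued map.
[cite: Balaban1985RegularSpaces, p.97 («This solution is an analytic function of λ»; «Taking r = (2max{|λ₀|, |Dλ₀|})⁻¹α₄»), (1.124) p.97] -/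
theorem analyticOnNhd_Dprime_line {L : ℕ} (hL : 2 ≤ L) {G : Subgroup 𝔸ˣ} (hG : AvgClosed d L G) {U₀ : Site d → Fin d → 𝔸ˣ}
    (hU : ∀ x κ, U₀ x κ ∈ G) {k : ℕ} (H' : XSpace d k 𝔸 →ₗ[ℂ] (Site d → 𝔸))
    {u₁ : Site d → 𝔸ˣ} {α₀ α₃ α₄ B₀' : ℝ}
    (hα : 0 < α₀) (hα3 : C0 d * α₀ ≤ 1 / 3) (hα2 : 2 * α₀ ≤ c2' d L)
    (h52 : pdev U₀ < α₀ * (((L : ℝ) ^ k)⁻¹) ^ 2)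
    (hB : 0 < B₀')
    (hH0 : ∀ (X : XSpace d k 𝔸) (x : Site d), ‖H' X x‖ ≤ B₀' * ‖X‖)
    (hH1 : ∀ (X : XSpace d k 𝔸) (x : Site d) (κ : Fin d),
      ‖cj (U₀ x κ) (H' X (x + e κ)) - H' X x‖ ≤ B₀' * ‖X‖ * ((L : ℝ) ^ k)⁻¹)
    (lam lam₀ : Site d → 𝔸) {m : ℝ}
    (h4a : ∀ (x : Site d) (κ : Fin d), ‖cj (U₀ x κ) (lam (x + e κ)) - lam x‖ < α₄ / 4 * ((L : ℝ) ^ k)⁻¹)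
    (h4b : ∀ x : Site d, ‖lam x‖ < α₄ / 4)
    (hm₀a : ∀ (x : Site d) (κ : Fin d), ‖cj (U₀ x κ) (lam₀ (x + e κ)) - lam₀ x‖ ≤ m * ((L : ℝ) ^ k)⁻¹)
    (hm₀b : ∀ x : Site d, ‖lam₀ x‖ ≤ m) (hm : 0 < m)
    (hu₁ : InLambda L U₀ u₁ k α₃ (((L : ℝ) ^ k)⁻¹))
    (hα₃ : 0 ≤ α₃) (hα₃' : α₃ ≤ 1 / 200)
    (hs₁ : 200 * C6 d * (2 * α₄) ≤ 1) (hs₂ : 12000 * ((d : ℝ) + 1) * L * (2 * α₄) ≤ 1)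
    (hs₃ : C4G d L * (α₀ + α₃ + 4 * (2 * α₄)) ≤ 1)
    (hs₄ : 1024 * ((d : ℝ) + 1) * ((d : ℝ) + 4) * L ^ 2 * α₀ ≤ 1) (hs₅ : 32 * ((d : ℝ) + 1) ^ 2 * C6 d * L ^ 2 * α₀ ≤ 1)
    (hs₆ : 16 * d * C5' d * C6 d * (L : ℝ) ^ 2 * α₀ ≤ 1) (hs₇ : 8 * d * C6 d * L * α₀ ≤ 1)
    (hsm : α₃ + α₄ ≤ 1 / (4 * B₀' * (2 * C2p d))) :
    AnalyticOnNhd ℂ (fun τ : ℂ => Dprime L U₀ u₁ k H' (α₄ / (2 * B₀')) (lam + τ • lam₀)) (ball (0 : ℂ) (α₄ / (4 * m))) := by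
  have hα₄ : 0 < α₄ := by linarith [norm_nonneg (lam 0), h4b 0]
  have hs : (0 : ℝ) ≤ ((L : ℝ) ^ k)⁻¹ := by positivity
  have hq : α₄ / 2 / 2 = α₄ / 4 := by ring
  have h4a' : ∀ (x : Site d) (κ : Fin d), ‖cj (U₀ x κ) (lam (x + e κ)) - lam x‖ < α₄ / 2 / 2 * ((L : ℝ) ^ k)⁻¹ := by
    rw [hq]; exact h4a
  have h4b' : ∀ x : Site d, ‖lam x‖ < α₄ / 2 / 2 := by rw [hq]; exact h4b
  have hmem : ∀ τ ∈ ball (0 : ℂ) (α₄ / (4 * m)),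
      (∀ (x : Site d) (κ : Fin d), ‖cj (U₀ x κ) ((lam + τ • lam₀) (x + e κ)) - (lam + τ • lam₀) x‖ < α₄ / 2 * ((L : ℝ) ^ k)⁻¹) ∧
        ∀ x : Site d, ‖(lam + τ • lam₀) x‖ < α₄ / 2 := fun τ hτ => by
    have hτ' : ‖τ‖ ≤ α₄ / 2 / (2 * m) := by
      rw [mem_ball_zero_iff] at hτ
      rw [div_div, show 2 * (2 * m) = 4 * m by ring]
      exact hτ.le
    exact B8Eq1123Concrete.line_mem_dom207 h4a' h4b' hm₀a hm₀b hm hs hτ'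
  have hγ : ∀ x, DifferentiableOn ℂ (fun τ : ℂ => (lam + τ • lam₀) x) (ball (0 : ℂ) (α₄ / (4 * m))) := fun x τ _ =>
    (analyticAt_const.fun_add (analyticAt_id.fun_smul analyticAt_const) :
      AnalyticAt ℂ (fun τ : ℂ => (lam + τ • lam₀) x) τ).differentiableAt.differentiableWithinAt
  exact analyticOnNhd_Dprime_comp (γ := fun τ : ℂ => lam + τ • lam₀) hL hG hU H' hα hα3 hα2 h52 hB hH0 hH1 isOpen_ball hγ
    (fun τ hτ => (hmem τ hτ).1) (fun τ hτ => (hmem τ hτ).2) hu₁ hα₃ hα₃' hα₄ hs₁ hs₂ hs₃ hs₄ hs₅ hs₆ hs₇ hsm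

/-- … in particular `τ ↦ D′(λ + τλ₀)` is analytic at `τ = 0` (hypotheses of `analyticOnNhd_Dprime_line`).
[cite: Balaban1985RegularSpaces, p.97 («This solution is an analytic function of λ»), (1.124) p.97] -/
theorem analyticAt_Dprime_line {L : ℕ} (hL : 2 ≤ L) {G : Subgroup 𝔸ˣ} (hG : AvgClosed d L G) {U₀ : Site d → Fin d → 𝔸ˣ}
    (hU : ∀ x κ, U₀ x κ ∈ G) {k : ℕ} (H' : XSpace d k 𝔸 →ₗ[ℂ] (Site d → 𝔸))
    {u₁ : Site d → 𝔸ˣ} {α₀ α₃ α₄ B₀' : ℝ}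
    (hα : 0 < α₀) (hα3 : C0 d * α₀ ≤ 1 / 3) (hα2 : 2 * α₀ ≤ c2' d L)
    (h52 : pdev U₀ < α₀ * (((L : ℝ) ^ k)⁻¹) ^ 2)
    (hB : 0 < B₀')
    (hH0 : ∀ (X : XSpace d k 𝔸) (x : Site d), ‖H' X x‖ ≤ B₀' * ‖X‖)
    (hH1 : ∀ (X : XSpace d k 𝔸) (x : Site d) (κ : Fin d),
      ‖cj (U₀ x κ) (H' X (x + e κ)) - H' X x‖ ≤ B₀' * ‖X‖ * ((L : ℝ) ^ k)⁻¹)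
    (lam lam₀ : Site d → 𝔸) {m : ℝ}
    (h4a : ∀ (x : Site d) (κ : Fin d), ‖cj (U₀ x κ) (lam (x + e κ)) - lam x‖ < α₄ / 4 * ((L : ℝ) ^ k)⁻¹)
    (h4b : ∀ x : Site d, ‖lam x‖ < α₄ / 4)
    (hm₀a : ∀ (x : Site d) (κ : Fin d), ‖cj (U₀ x κ) (lam₀ (x + e κ)) - lam₀ x‖ ≤ m * ((L : ℝ) ^ k)⁻¹)
    (hm₀b : ∀ x : Site d, ‖lam₀ x‖ ≤ m) (hm : 0 < m)
    (hu₁ : InLambda L U₀ u₁ k α₃ (((L : ℝ) ^ k)⁻¹))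
    (hα₃ : 0 ≤ α₃) (hα₃' : α₃ ≤ 1 / 200)
    (hs₁ : 200 * C6 d * (2 * α₄) ≤ 1) (hs₂ : 12000 * ((d : ℝ) + 1) * L * (2 * α₄) ≤ 1)
    (hs₃ : C4G d L * (α₀ + α₃ + 4 * (2 * α₄)) ≤ 1)
    (hs₄ : 1024 * ((d : ℝ) + 1) * ((d : ℝ) + 4) * L ^ 2 * α₀ ≤ 1) (hs₅ : 32 * ((d : ℝ) + 1) ^ 2 * C6 d * L ^ 2 * α₀ ≤ 1)
    (hs₆ : 16 * d * C5' d * C6 d * (L : ℝ) ^ 2 * α₀ ≤ 1) (hs₇ : 8 * d * C6 d * L * α₀ ≤ 1)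
    (hsm : α₃ + α₄ ≤ 1 / (4 * B₀' * (2 * C2p d))) :
    AnalyticAt ℂ (fun τ : ℂ => Dprime L U₀ u₁ k H' (α₄ / (2 * B₀')) (lam + τ • lam₀)) 0 := by
  have hα₄ : 0 < α₄ := by linarith [norm_nonneg (lam 0), h4b 0]
  exact analyticOnNhd_Dprime_line hL hG hU H' hα hα3 hα2 h52 hB hH0 hH1 lam lam₀ h4a h4b hm₀a hm₀b hm hu₁ hα₃ hα₃' hs₁ hs₂
    hs₃ hs₄ hs₅ hs₆ hs₇ hsm 0 (mem_ball_self (by positivity))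

end DprimeAnalytic

end Literature.MathematicalPhysics.QuantumFieldTheory.Balaban1983to89.B8Eq1117ConcreteAnalytic

end
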